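import Mathlib
import HarnessLib

/-!
# Taylor's formula along a line for smooth vector-valued functions on a normed space
# (def-free helper toward H4a `MolliApprox` of the registered stub `stub_singleSlot`, AtomicSynthesis ⟨stmt-QuantumFields-28126⟩,
# path α of the lines on 23138 / 22956; planner ym-idea-11 g14 reduction `g14/oneStepSplit.lean`)

For `g : E → F` smooth (`E`, `F` real normed spaces), `x v : E` and `τ > 0`:

* `iteratedDeriv_comp_line`: the `j`-th derivative of `t ↦ g(x + t•v)` is `D^j g(x + t v)(v, …, v)`
  (Mathlib `ContinuousLinearMap.iteratedFDeriv_comp_right` + `iteratedFDeriv_comp_add_left`);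
* ★ `norm_sub_taylor_line_le`: `‖g(x + τv) − Σ_{j ≤ n} (τ^j/j!) D^j g(x)(v,…,v)‖ ≤ B ‖v‖^{n+1} τ^{n+1}/n!` whenever
  `‖D^{n+1} g‖ ≤ B` everywhere (Mathlib's vector-valued `taylor_mean_remainder_bound` on the segment).

THEOREMS ONLY; Mathlib only; no `sorry`; standard axioms.  HONEST FRAMING: folklore calculus serving a registered L stub of lines on
the RECORD-label R-floor cruxes 23138/22956; nothing here touches Yang–Mills; the YM mass gap is NOT proved.  Width seat
`ym-line-sfw-p2-w3` g36 (cell ym-idea-1, free hands), `--supports stmt-QuantumFields-28126`. [folklore]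
-/

set_option autoImplicit false

noncomputable section

open scoped BigOperators ContDiff Topology Nat
open Set

namespace Summit.QuantumFields.YangMills.Theorems.AtomicSynthesisMolli

variable {E : Type*} [NormedAddCommGroup E] [NormedSpace ℝ E] {F : Type*} [NormedAddCommGroup F] [NormedSpace ℝ F]

/-- The restriction of a smooth function to the line `t ↦ x + t•v` is smooth. -/
theorem contDiff_comp_line {g : E → F} {n : WithTop ℕ∞} (hg : ContDiff ℝ n g) (x v : E) :
    ContDiff ℝ n fun t : ℝ => g (x + t • v) :=
  hg.comp ((contDiff_const.add (contDiff_id.smul contDiff_const)).of_le le_top)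

/-- **Derivatives along a line**: the `j`-th Fréchet derivative of `t ↦ g(x + t•v)` at `t`, evaluated on `(1,…,1)`, is
`D^j g(x + t v)(v, …, v)`. [folklore] -/
theorem iteratedFDeriv_comp_line {g : E → F} (hg : ContDiff ℝ ∞ g) (x v : E) (j : ℕ) (t : ℝ) :
    iteratedFDeriv ℝ j (fun s : ℝ => g (x + s • v)) t (fun _ => 1) = iteratedFDeriv ℝ j g (x + t • v) (fun _ => v) := by
  set L : ℝ →L[ℝ] E := ContinuousLinearMap.smulRight (1 : ℝ →L[ℝ] ℝ) v with hL
  have hLapp : ∀ s : ℝ, L s = s • v := fun s => by simp [hL]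
  have hcomp : (fun s : ℝ => g (x + s • v)) = (fun z : E => g (x + z)) ∘ L := by
    funext s; simp [hLapp]
  have hg' : ContDiff ℝ ∞ fun z : E => g (x + z) := hg.comp (contDiff_const.add contDiff_id)
  rw [hcomp, L.iteratedFDeriv_comp_right hg' t (by exact_mod_cast le_top), ContinuousMultilinearMap.compContinuousLinearMap_apply,
    iteratedFDeriv_comp_add_left, hLapp]
  congr 1
  funext i
  rw [hLapp, one_smul]

/-- The same for the one-dimensional iterated derivative `iteratedDeriv`. [folklore] -/
theorem iteratedDeriv_comp_line {g : E → F} (hg : ContDiff ℝ ∞ g) (x v : E) (j : ℕ) (t : ℝ) :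
    iteratedDeriv j (fun s : ℝ => g (x + s • v)) t = iteratedFDeriv ℝ j g (x + t • v) (fun _ => v) := by
  rw [iteratedDeriv_eq_iteratedFDeriv]
  exact iteratedFDeriv_comp_line hg x v j t

/-- Norm of a diagonal evaluation of an iterated derivative: `‖D^j g(z)(v,…,v)‖ ≤ ‖D^j g(z)‖ ‖v‖^j`. [folklore] -/
theorem norm_iteratedFDeriv_apply_diag_le (g : E → F) (z v : E) (j : ℕ) :
    ‖iteratedFDeriv ℝ j g z (fun _ => v)‖ ≤ ‖iteratedFDeriv ℝ j g z‖ * ‖v‖ ^ j := by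
  have h := (iteratedFDeriv ℝ j g z).le_opNorm (fun _ => v)
  simpa [Finset.prod_const, Finset.card_fin] using h

/-- ★ **Taylor's formula along a line, with remainder bound.**  If `g : E → F` is smooth with `‖D^{n+1} g‖ ≤ B` everywhere,
then for `τ > 0`
`‖g(x + τ•v) − Σ_{j ≤ n} (τ^j / j!) • D^j g(x)(v,…,v)‖ ≤ B ‖v‖^{n+1} τ^{n+1} / n!`. [folklore] -/
theorem norm_sub_taylor_line_le {g : E → F} (hg : ContDiff ℝ ∞ g) (x v : E) {τ : ℝ} (hτ : 0 < τ) (n : ℕ) {B : ℝ}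
    (hB : ∀ z, ‖iteratedFDeriv ℝ (n + 1) g z‖ ≤ B) :
    ‖g (x + τ • v) - ∑ j ∈ Finset.range (n + 1), ((j ! : ℝ)⁻¹ * τ ^ j) • iteratedFDeriv ℝ j g x (fun _ => v)‖ ≤
      B * ‖v‖ ^ (n + 1) * τ ^ (n + 1) / n ! := by
  set ψ : ℝ → F := fun s => g (x + s • v) with hψ
  have hψd : ContDiff ℝ ∞ ψ := contDiff_comp_line hg x v
  have hU : UniqueDiffOn ℝ (Icc (0 : ℝ) τ) := uniqueDiffOn_Icc hτ
  -- the derivatives of `ψ` inside `[0, τ]`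
  have hder : ∀ (j : ℕ) (y : ℝ), y ∈ Icc (0 : ℝ) τ →
      iteratedDerivWithin j ψ (Icc 0 τ) y = iteratedFDeriv ℝ j g (x + y • v) (fun _ => v) := by
    intro j y hy
    rw [iteratedDerivWithin_eq_iteratedDeriv hU ((hψd.of_le (by exact_mod_cast le_top)).contDiffAt) hy]
    exact iteratedDeriv_comp_line hg x v j y
  have hB0 : 0 ≤ B := (norm_nonneg _).trans (hB x)
  have hC : ∀ y ∈ Icc (0 : ℝ) τ, ‖iteratedDerivWithin (n + 1) ψ (Icc 0 τ) y‖ ≤ B * ‖v‖ ^ (n + 1) := by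
    intro y hy
    rw [hder (n + 1) y hy]
    exact (norm_iteratedFDeriv_apply_diag_le g _ v (n + 1)).trans
      (mul_le_mul_of_nonneg_right (hB _) (pow_nonneg (norm_nonneg _) _))
  have key := taylor_mean_remainder_bound (f := ψ) (a := 0) (b := τ) (x := τ) (n := n) hτ.le
    ((hψd.of_le (by exact_mod_cast le_top)).contDiffOn) (right_mem_Icc.2 hτ.le) hC
  -- identify the Taylor polynomial
  have hT : taylorWithinEval ψ n (Icc 0 τ) 0 τ =
      ∑ j ∈ Finset.range (n + 1), ((j ! : ℝ)⁻¹ * τ ^ j) • iteratedFDeriv ℝ j g x (fun _ => v) := by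
    rw [taylor_within_apply]
    refine Finset.sum_congr rfl fun j _ => ?_
    rw [hder j 0 (left_mem_Icc.2 hτ.le), zero_smul, add_zero, sub_zero]
  have hψτ : ψ τ = g (x + τ • v) := rfl
  rw [hT, hψτ, sub_zero] at key
  calc ‖g (x + τ • v) - ∑ j ∈ Finset.range (n + 1), ((j ! : ℝ)⁻¹ * τ ^ j) • iteratedFDeriv ℝ j g x (fun _ => v)‖
      ≤ B * ‖v‖ ^ (n + 1) * τ ^ (n + 1) / n ! := key

end Summit.QuantumFields.YangMills.Theorems.AtomicSynthesisMolli

end
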